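import Mathlib.Algebra.MvPolynomial.CommRing
import Mathlib.RingTheory.MvPolynomial.Basic
import Mathlib.RingTheory.Ideal.Maps
import Mathlib.RingTheory.Polynomial.Basic
import Mathlib.FieldTheory.Finite.Basic
import HarnessLib

/-!
# Crux `PatchingRelPerfect` (stmt-ResolutionOfSingularities-16161), chain w52 — TargetsF3 (m)
# «M2-strong», COMBINATORIAL HALF, Route K brick K3(b): an ideal of a polynomial ring over an
# infinite field which is stable under the coordinate scalings `x_i ↦ c·x_i` (`c ≠ 0`) is MONOMIAL

[OURS · L1 W5.2 · design memo `L/res-type-075/M2STRONG-COMBINATORIAL-HALF.md` §3 K3(b); fact-free;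
nothing here is a statement of the manuscript under review]

Route K transfers the tree's functorial order reduction (Kollár 2007, Thm. 3.69 with 3.34.1,
`Kollar2007Thm3_103.orderReduction`) to the combinatorial polyhedra game: the scalings by the
rational points of the torus are automorphisms of the realised triple, so by functoriality every
centre of `𝓑𝓜𝓞₁` is stable under them; this file supplies the algebra turning «stable under all
scalings» into «cut out by monomials»:

* `aeval_scale_monomial` — `x_i ↦ c x_i` multiplies the monomial `a·x^m` by `c^{m_i}`;
* `degPiece i k f` — the part of `f` of `x_i`-degree `k` (a finite sum of its terms);
* `degPiece_mem_of_scaling_stable` — if `I` is stable under `x_i ↦ c x_i` for all `c ≠ 0` and the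
  field is infinite, every `x_i`-degree piece of every `f ∈ I` lies in `I` (apply the operators
  `φ_c − c^l` for the other occurring degrees `l`, with `c` not a root of unity of small order);
* `monomial_mem_of_scaling_stable` — if `I` is stable under all coordinate scalings, every term of
  every `f ∈ I` lies in `I`; `eq_span_monomial_of_scaling_stable` — `I` is spanned by the monic
  monomials it contains.
-/

-- `Summit.<Summit>.<Sub>.Theorems` with `Sub = Summit` (single-conjunct summit, D-0017)
set_option linter.dupNamespace false

namespace Summit.ResolutionOfSingularities.ResolutionOfSingularities.Theorems

namespace PolyhedraGame

open MvPolynomial Finset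

variable {σ : Type*} {K : Type*} [Field K]

/-! ## The scaling `x_i ↦ c·x_i` on monomials -/

/-- [OURS] The coordinate scaling `x_i ↦ c·x_i` (as the substitution `aeval (update X i (C c * X i))`)
multiplies the term `a·x^m` by `c^{m i}`. -/
theorem aeval_scale_monomial [DecidableEq σ] (i : σ) (c : K) (m : σ →₀ ℕ) (a : K) :
    aeval (Function.update X i (C c * X i)) (monomial m a) =
      monomial m (c ^ (m i) * a) := by
  rw [aeval_monomial, Finsupp.prod]
  have hsplit : ∀ j ∈ m.support, (Function.update X i (C c * X i) j) ^ (m j) =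
      C (if j = i then c ^ (m j) else 1) * X j ^ (m j) := by
    intro j _
    by_cases hj : j = i
    · subst hj
      rw [Function.update_self, if_pos rfl, mul_pow, map_pow]
    · rw [Function.update_of_ne hj, if_neg hj, map_one, one_mul]
  rw [Finset.prod_congr rfl hsplit, Finset.prod_mul_distrib, ← map_prod]
  have hc : (∏ j ∈ m.support, (if j = i then c ^ (m j) else (1 : K))) = c ^ (m i) := by
    rw [Finset.prod_ite_eq']
    split_ifs with h
    · rfl
    · rw [Finsupp.notMem_support_iff.mp h, pow_zero]
  rw [hc, monomial_eq, MvPolynomial.algebraMap_eq, map_mul, Finsupp.prod]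
  ring

/-! ## Degree pieces -/

/-- [OURS] The part of `f` consisting of its terms of `x_i`-degree `k`. -/
noncomputable def degPiece (i : σ) (k : ℕ) (f : MvPolynomial σ K) : MvPolynomial σ K :=
  ∑ m ∈ f.support with m i = k, monomial m (coeff m f)

/-- [OURS] `f` is the sum of its `x_i`-degree pieces over the occurring degrees. -/
theorem sum_degPiece (i : σ) (f : MvPolynomial σ K) :
    ∑ k ∈ f.support.image (fun m => m i), degPiece i k f = f := by
  classical
  unfold degPiece
  rw [Finset.sum_fiberwise_of_maps_to (fun m hm => Finset.mem_image_of_mem _ hm)]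
  exact f.as_sum.symm

/-- [OURS] The scaling `x_i ↦ c·x_i` multiplies the `x_i`-degree-`k` piece by `c^k`. -/
theorem aeval_scale_degPiece [DecidableEq σ] (i : σ) (c : K) (k : ℕ) (f : MvPolynomial σ K) :
    aeval (Function.update X i (C c * X i)) (degPiece i k f) = C (c ^ k) * degPiece i k f := by
  unfold degPiece
  rw [map_sum, Finset.mul_sum]
  refine Finset.sum_congr rfl fun m hm => ?_
  rw [Finset.mem_filter] at hm
  rw [aeval_scale_monomial, hm.2, C_mul_monomial]

/-- [OURS] A degree piece of a degree piece: the same piece if the degrees agree, else zero. -/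
theorem coeff_degPiece [DecidableEq σ] (i : σ) (k : ℕ) (f : MvPolynomial σ K) (m : σ →₀ ℕ) :
    coeff m (degPiece i k f) = if m i = k then coeff m f else 0 := by
  unfold degPiece
  rw [coeff_sum]
  simp only [coeff_monomial]
  split_ifs with h
  · rw [Finset.sum_eq_single m]
    · simp
    · intro m' hm' hne; simp [hne]
    · intro hm
      simp only [Finset.mem_filter, mem_support_iff, not_and] at hm
      by_cases h0 : coeff m f = 0
      · simp [h0]
      · exact absurd h (hm h0)
  · refine Finset.sum_eq_zero fun m' hm' => ?_
    rw [Finset.mem_filter] at hm'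
    by_cases hmm : m' = m
    · subst hmm; exact absurd hm'.2 h
    · simp [hmm]

/-! ## Scaling-stable ideals contain the degree pieces of their elements -/

/-- [OURS] In an infinite field, for a finite set `D` of positive integers there is a non-zero `c`
with `c ^ a ≠ 1` for every `a ∈ D` (finitely many roots of unity of bounded order). -/
theorem exists_ne_zero_pow_ne_one [Infinite K] (D : Finset ℕ) (hD : ∀ a ∈ D, 0 < a) :
    ∃ c : K, c ≠ 0 ∧ ∀ a ∈ D, c ^ a ≠ 1 := by
  classical
  -- the bad set: `0` and the roots of `X^a - 1`, `a ∈ D`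
  let bad : Finset K := insert 0 (D.biUnion fun a => (Polynomial.nthRoots a (1 : K)).toFinset)
  obtain ⟨c, hc⟩ := Infinite.exists_notMem_finset bad
  refine ⟨c, ?_, ?_⟩
  · intro h; apply hc; simp [bad, h]
  · intro a ha h
    apply hc
    simp only [bad, Finset.mem_insert, Finset.mem_biUnion, Multiset.mem_toFinset]
    exact Or.inr ⟨a, ha, (Polynomial.mem_nthRoots (hD a ha)).mpr h⟩

/-- [OURS] **Degree pieces of elements of a scaling-stable ideal lie in the ideal.**  If the field is
infinite and the ideal `I` is stable under `x_i ↦ c·x_i` for every `c ≠ 0`, then for every `f ∈ I`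
and every `k`, `degPiece i k f ∈ I`.  Proof: with `c` such that `c^k ≠ c^l` for the other occurring
degrees `l`, apply the `I`-preserving operators `φ_c − c^l·id` for all those `l`: they kill the other
pieces and multiply `degPiece i k f` by the unit `∏ (c^k − c^l)`. -/
theorem degPiece_mem_of_scaling_stable [DecidableEq σ] [Infinite K] {I : Ideal (MvPolynomial σ K)}
    (i : σ) (hI : ∀ c : K, c ≠ 0 → ∀ f ∈ I, aeval (Function.update X i (C c * X i)) f ∈ I)
    {f : MvPolynomial σ K} (hf : f ∈ I) (k : ℕ) : degPiece i k f ∈ I := by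
  classical
  set Ks : Finset ℕ := f.support.image (fun m => m i) with hKs
  -- if `k` does not occur the piece is `0`
  by_cases hk : k ∈ Ks
  swap
  · have : degPiece i k f = 0 := by
      unfold degPiece
      refine Finset.sum_eq_zero fun m hm => ?_
      rw [Finset.mem_filter] at hm
      exact absurd (Finset.mem_image.mpr ⟨m, hm.1, hm.2⟩) hk
    rw [this]; exact I.zero_mem
  -- choose `c ≠ 0` with `c^k ≠ c^l` for all occurring `l ≠ k`
  obtain ⟨c, hc0, hc⟩ := exists_ne_zero_pow_ne_one (K := K)
    ((Ks.erase k).image fun l => if l < k then k - l else l - k) (by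
      intro a ha
      obtain ⟨l, hl, rfl⟩ := Finset.mem_image.mp ha
      have hlk : l ≠ k := (Finset.mem_erase.mp hl).1
      split_ifs with h <;> omega)
  have hpow : ∀ l ∈ Ks.erase k, c ^ k - c ^ l ≠ 0 := by
    intro l hl habs
    have hlk : l ≠ k := (Finset.mem_erase.mp hl).1
    have hmem : (if l < k then k - l else l - k) ∈ (Ks.erase k).image
        fun l => if l < k then k - l else l - k := Finset.mem_image.mpr ⟨l, hl, rfl⟩
    have h1 := hc _ hmem
    have heq : c ^ k = c ^ l := sub_eq_zero.mp habs
    split_ifs at h1 with hlt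
    · apply h1
      have h3 : c ^ (k - l) * c ^ l = c ^ l := by
        rw [← pow_add, Nat.sub_add_cancel hlt.le]; exact heq
      exact (mul_eq_right₀ (pow_ne_zero _ hc0)).mp h3
    · apply h1
      have h3 : c ^ (l - k) * c ^ k = c ^ k := by
        rw [← pow_add, Nat.sub_add_cancel (by omega)]; exact heq.symm
      exact (mul_eq_right₀ (pow_ne_zero _ hc0)).mp h3
  -- the operator induction over `S ⊆ Ks.erase k`
  have key : ∀ S : Finset ℕ, S ⊆ Ks.erase k →
      (∑ k' ∈ Ks, (∏ l ∈ S, (c ^ k' - c ^ l)) • degPiece i k' f) ∈ I := by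
    intro S
    induction S using Finset.induction with
    | empty =>
      intro _
      simp only [Finset.prod_empty, one_smul]
      rw [sum_degPiece]; exact hf
    | insert l₀ S hl₀ ih =>
      intro hS
      have hS' : S ⊆ Ks.erase k := fun x hx => hS (Finset.mem_insert_of_mem hx)
      have hg := ih hS'
      -- apply `φ_c - c^{l₀}`
      have h1 := hI c hc0 _ hg
      have h2 : aeval (Function.update X i (C c * X i))
            (∑ k' ∈ Ks, (∏ l ∈ S, (c ^ k' - c ^ l)) • degPiece i k' f) -
          C (c ^ l₀) * (∑ k' ∈ Ks, (∏ l ∈ S, (c ^ k' - c ^ l)) • degPiece i k' f) ∈ I :=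
        I.sub_mem h1 (I.mul_mem_left _ hg)
      have h3 : aeval (Function.update X i (C c * X i))
            (∑ k' ∈ Ks, (∏ l ∈ S, (c ^ k' - c ^ l)) • degPiece i k' f) -
          C (c ^ l₀) * (∑ k' ∈ Ks, (∏ l ∈ S, (c ^ k' - c ^ l)) • degPiece i k' f) =
          ∑ k' ∈ Ks, (∏ l ∈ insert l₀ S, (c ^ k' - c ^ l)) • degPiece i k' f := by
        rw [map_sum, Finset.mul_sum, ← Finset.sum_sub_distrib]
        refine Finset.sum_congr rfl fun k' _ => ?_
        rw [map_smul, aeval_scale_degPiece, Finset.prod_insert hl₀]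
        simp only [smul_eq_C_mul, map_mul, map_sub]
        ring
      rw [h3] at h2
      exact h2
  have hfin := key (Ks.erase k) le_rfl
  -- at `S = Ks.erase k` only the `k` term survives
  rw [Finset.sum_eq_single_of_mem k hk] at hfin
  · -- divide by the unit scalar
    have hu : (∏ l ∈ Ks.erase k, (c ^ k - c ^ l)) ≠ 0 := Finset.prod_ne_zero_iff.mpr hpow
    have := I.mul_mem_left (C (∏ l ∈ Ks.erase k, (c ^ k - c ^ l))⁻¹) hfin
    rwa [smul_eq_C_mul, ← mul_assoc, ← map_mul, inv_mul_cancel₀ hu, map_one, one_mul] at this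
  · intro k' hk' hne
    rw [Finset.prod_eq_zero (Finset.mem_erase.mpr ⟨hne, hk'⟩) (sub_self _), zero_smul]

/-! ## All coordinates: scaling-stable ideals are monomial -/

/-- [OURS] Refinement by a finite set of coordinates: the part of `f` whose exponents agree with
`e` on `V`. -/
noncomputable def multiPiece (V : Finset σ) (e : σ → ℕ) (f : MvPolynomial σ K) : MvPolynomial σ K :=
  ∑ m ∈ f.support with (∀ i ∈ V, m i = e i), monomial m (coeff m f)

/-- [OURS] Coefficients of a multi-piece. -/
theorem coeff_multiPiece [DecidableEq σ] (V : Finset σ) (e : σ → ℕ) (f : MvPolynomial σ K)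
    (m : σ →₀ ℕ) : coeff m (multiPiece V e f) = if (∀ i ∈ V, m i = e i) then coeff m f else 0 := by
  classical
  unfold multiPiece
  rw [coeff_sum]
  simp only [coeff_monomial]
  split_ifs with h
  · rw [Finset.sum_eq_single m]
    · simp
    · intro m' _ hne; simp [hne]
    · intro hm
      simp only [Finset.mem_filter, mem_support_iff, not_and] at hm
      by_cases h0 : coeff m f = 0
      · simp [h0]
      · exact absurd h (hm h0)
  · refine Finset.sum_eq_zero fun m' hm' => ?_
    rw [Finset.mem_filter] at hm'
    by_cases hmm : m' = m
    · subst hmm; exact absurd hm'.2 h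
    · simp [hmm]

/-- [OURS] Adding one coordinate to the refinement = taking a degree piece of the multi-piece. -/
theorem multiPiece_insert [DecidableEq σ] (V : Finset σ) (i : σ) (e : σ → ℕ) (f : MvPolynomial σ K) :
    multiPiece (insert i V) e f = degPiece i (e i) (multiPiece V e f) := by
  classical
  ext m
  rw [coeff_multiPiece, coeff_degPiece, coeff_multiPiece]
  by_cases h1 : m i = e i <;> by_cases h2 : (∀ j ∈ V, m j = e j) <;>
    simp [h1, h2]

/-- [OURS] The empty refinement is `f` itself. -/
theorem multiPiece_empty [DecidableEq σ] (e : σ → ℕ) (f : MvPolynomial σ K) :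
    multiPiece ∅ e f = f := by
  classical
  ext m
  rw [coeff_multiPiece]
  simp

/-- [OURS] **Every term of an element of an ideal stable under ALL coordinate scalings lies in the
ideal** (infinite field). -/
theorem monomial_mem_of_scaling_stable [DecidableEq σ] [Infinite K] {I : Ideal (MvPolynomial σ K)}
    (hI : ∀ (i : σ) (c : K), c ≠ 0 → ∀ f ∈ I, aeval (Function.update X i (C c * X i)) f ∈ I)
    {f : MvPolynomial σ K} (hf : f ∈ I) (m : σ →₀ ℕ) : monomial m (coeff m f) ∈ I := by
  classical
  -- refine along all coordinates occurring in `f` or in `m`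
  have hV : ∀ V : Finset σ, multiPiece V m f ∈ I := by
    intro V
    induction V using Finset.induction with
    | empty => rw [multiPiece_empty]; exact hf
    | insert i V _ ih =>
      rw [multiPiece_insert]
      exact degPiece_mem_of_scaling_stable i (hI i) ih (m i)
  have key : multiPiece (f.support.biUnion (fun m' => m'.support) ∪ m.support) m f =
      monomial m (coeff m f) := by
    ext m'
    rw [coeff_multiPiece, coeff_monomial]
    by_cases hmm : m = m'
    · subst hmm; simp
    · rw [if_neg hmm]
      split_ifs with h
      · -- `m' ≠ m` but they agree on all relevant coordinates ⇒ `coeff m' f = 0`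
        by_contra hne
        apply hmm
        ext j
        by_cases hj : j ∈ f.support.biUnion (fun m' => m'.support) ∪ m.support
        · exact (h j hj).symm
        · rw [Finset.mem_union, not_or, Finset.mem_biUnion, not_exists] at hj
          have h1 : m j = 0 := Finsupp.notMem_support_iff.mp hj.2
          have h2 : m' j = 0 := by
            by_contra h2
            exact hj.1 m' ⟨mem_support_iff.mpr hne, Finsupp.mem_support_iff.mpr h2⟩
          rw [h1, h2]
      · rfl
  rw [← key]
  exact hV _

/-- [OURS] **An ideal stable under all coordinate scalings is spanned by the monic monomials it
contains** (infinite field): the «torus-stable ideals are monomial» lemma of Route K, K3(b). -/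
theorem eq_span_monomial_of_scaling_stable [DecidableEq σ] [Infinite K] {I : Ideal (MvPolynomial σ K)}
    (hI : ∀ (i : σ) (c : K), c ≠ 0 → ∀ f ∈ I, aeval (Function.update X i (C c * X i)) f ∈ I) :
    I = Ideal.span {g | ∃ m : σ →₀ ℕ, g = monomial m 1 ∧ monomial m (1 : K) ∈ I} := by
  classical
  apply le_antisymm
  · intro f hf
    rw [f.as_sum]
    refine Ideal.sum_mem _ fun m hm => ?_
    have hmon := monomial_mem_of_scaling_stable hI hf m
    have hcoef : coeff m f ≠ 0 := mem_support_iff.mp hm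
    have h1 : monomial m (1 : K) ∈ I := by
      have := I.mul_mem_left (C (coeff m f)⁻¹) hmon
      rwa [C_mul_monomial, inv_mul_cancel₀ hcoef] at this
    have : monomial m (coeff m f) = C (coeff m f) * monomial m 1 := by
      rw [C_mul_monomial, mul_one]
    rw [this]
    refine Ideal.mul_mem_left _ _ (Ideal.subset_span ?_)
    exact ⟨m, rfl, h1⟩
  · apply Ideal.span_le.mpr
    rintro g ⟨m, rfl, hm⟩
    exact hm

end PolyhedraGame

end Summit.ResolutionOfSingularities.ResolutionOfSingularities.Theorems
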